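import Summits.Ventures.HSemireg.WedgePointPairPowersKernelSpan
import Summits.Ventures.HSemireg.WedgePointPairPowersKernelDim

/-!
# Venture HSemireg — the KERNEL CENSUS of the `n`-fold box of `m`-dimensional point pairs in closed form: alive, killed and
# collapsed monomials counted by the ALIVE POLYNOMIAL `A_m(t) = 2(1+t)^m − 1 = P_m(t) + t^m` (every `m`, `n`, `k`)

HONEST FRAMING. Part of the Lean index of the computation cell `pub-hsemireg` (seat p10 gen 7, Sunday typer «UNIFORM-IN-n»).
Natural-number / integer POLYNOMIAL ARITHMETIC and finite combinatorics ONLY (no exterior-algebra computation beyond gen 6's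
definitions): no variety, no cohomology theory, no sheaf, no Ext group and no semiregularity map is constructed here; nothing here
says that HC / HC_CM / HC_AV holds; no Literature fact is declared or used.  Custodian versions cited: STRUCTURE.md v1.0-SIGNED
9b196a05977dd067 §1.1 C4 / C10 (kernel names and the numbers `2n²`, `5n`); theory/FORMULA-N.md PART A §2.2 / §8 F-2 (th-6: `P_n =
2(1+t)ⁿ − 1 − tⁿ`, «top-line collapse»).

gen 6 (`WedgePointPairPowersKernelSpan.lean`) split the degree-`k` monomials of the `n`-fold box (generators `Fin ((m+m)·n)`, blocks
`X_i ⊔ Y_i`) into ALIVE (`aliveSet`: every block part inside `X_i` or inside `Y_i`) and KILLED (`killedSet`), with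
`#alive + #killed = C((m+m)n, k)` and, for `k < m` only, `#alive = [t^k]P_mⁿ`.  THIS FILE counts them in EVERY degree:
* §1 the alive LOCAL parts of one block are the subsets of `X` and the subsets of `Y` (`laSet`); their census by size is the
  ALIVE POLYNOMIAL **`Σ_{t alive local} t^{|t|} = 2(1+t)^m − 1 = P_m(t) + t^m`** (`sum_laSet`: th-6's `FormulaN.Uniform.P` plus the ONE
  top monomial `t^m` — the full half `Y`, whose class coincides with that of the full half `X`: the «top-line collapse»);
* §2 alive `k`-sets ↔ families of alive local parts with `k` letters in total (`card_aliveSet_eq_card_Aset`, glue / block parts);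
* §3 generating function `Σ_g t^{|g|} = (P_m + t^m)ⁿ` (`sum_X_pow_akf`) and coefficient extraction;
* §4 THE CENSUS, every `m`, `n`, `k`: **`card_aliveSet_cast`: `#alive(k) = [t^k](P_m + t^m)ⁿ`**, **`card_killedSet_cast`:
  `#killed(k) = C((m+m)n, k) − [t^k](P_m + t^m)ⁿ`**, and (with p10 gen 4's `card_Kset`: `#classes = [t^k]P_mⁿ`, `m ≥ 1`)
  **`card_aliveSet_sub_card_Kset`: `#alive(k) − #classes(k) = [t^k]((P_m + t^m)ⁿ − P_mⁿ) = Σ_{j ≥ 1} C(n,j)·[t^{k−jm}]P_m^{n−j}`**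
  (`coeff_alive_pow_sub_eq_sum`: `j` = the number of fully collapsed blocks; cast lemma `coeff_pairPoly_pow_cast` from the definition-free
  leaf `WedgePointPairPowersKernelDim`) — by the sibling leaf `WedgePointPairPowersKernelCollapse`
  (`card_canonSet_eq_card_Kset`, `card_canonSet_add_card_collapsedSet`) this difference IS the number of collapsed `k`-sets, i.e. of
  collapse binomials in the kernel; so the three kernel-side polynomials of the box are
  `Σ_k #killed t^k = (1+t)^{(m+m)n} − (P_m + t^m)ⁿ`, `Σ_k #collapsed t^k = (P_m + t^m)ⁿ − P_mⁿ`, `Σ_k rank t^k = P_mⁿ`.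
NOT here: the Ext side; the identification `#alive − #classes = #collapsed` is quoted from the sibling leaf, not re-proved.
Namespace `Summit.Ventures.HSemireg.Wedge.PairPowers`; new names only.
-/

open Module Set Set.powersetCard Polynomial

namespace Summit.Ventures.HSemireg.Wedge.PairPowers

open Summit.Ventures.HSemireg.Wedge Summit.Ventures.HSemireg.Wedge.Kunneth

variable {m n : ℕ}

/-! ## §1. Alive local parts and the alive polynomial `2(1+t)^m − 1 = P_m + t^m` -/

variable (m) in
/-- the ALIVE LOCAL PARTS of one block: the subsets of the half `X` and the subsets of the half `Y`. -/
def laSet : Finset (Finset (Fin (m + m))) := (Xs m).powerset ∪ (Ys m).powerset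

/-- membership in `laSet`. -/
lemma mem_laSet {t : Finset (Fin (m + m))} : t ∈ laSet m ↔ t ⊆ Xs m ∨ t ⊆ Ys m := by
  rw [laSet, Finset.mem_union, Finset.mem_powerset, Finset.mem_powerset]

/-- gen 6's aliveness of a block part is membership in `laSet`. -/
lemma alive_iff_mem_laSet {t : Finset (Fin (m + m))} : (Disjoint t (Ys m) ∨ Disjoint t (Xs m)) ↔ t ∈ laSet m := by
  rw [mem_laSet, WedgePair.disjoint_Y_iff_subset_X, WedgePair.disjoint_X_iff_subset_Y]

variable (m) in
/-- the type of alive local parts. -/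
abbrev La : Type := ↥(laSet m)

/-- only the empty part lies in both halves. -/
lemma powerset_Xs_inter_powerset_Ys : (Xs m).powerset ∩ (Ys m).powerset = {∅} := by
  ext t
  rw [Finset.mem_inter, Finset.mem_powerset, Finset.mem_powerset, Finset.mem_singleton, ← Finset.subset_inter_iff,
    Finset.disjoint_iff_inter_eq_empty.mp (WedgePair.disjoint_XY m), Finset.subset_empty]

/-- the size census of the subsets of a set: `Σ_{t ⊆ S} X^{|t|} = (1 + X)^{|S|}`. -/
lemma sum_powerset_X_pow_card (S : Finset (Fin (m + m))) : ∑ t ∈ S.powerset, (X : ℤ[X]) ^ t.card = (1 + X) ^ S.card := by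
  rw [add_comm (1 : ℤ[X]) X, ← Finset.sum_pow_mul_eq_add_pow X (1 : ℤ[X]) S]
  exact Finset.sum_congr rfl fun t _ => by rw [one_pow, mul_one]

/-- **the ALIVE POLYNOMIAL**: `Σ_{t alive local} X^{|t|} = 2(1+X)^m − 1 = P_m + X^m` (th-6's `P_m = 2(1+X)^m − 1 − X^m`). -/
theorem sum_laSet : ∑ t ∈ laSet m, (X : ℤ[X]) ^ t.card = FormulaN.Uniform.P m + X ^ m := by
  have h := Finset.sum_union_inter (s₁ := (Xs m).powerset) (s₂ := (Ys m).powerset) (f := fun t => (X : ℤ[X]) ^ t.card)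
  rw [powerset_Xs_inter_powerset_Ys, sum_powerset_X_pow_card, sum_powerset_X_pow_card, WedgePair.card_Xset,
    WedgePair.card_Yset] at h
  simp only [Finset.sum_singleton, Finset.card_empty, pow_zero] at h
  rw [laSet, FormulaN.Uniform.P]
  linear_combination h

/-- the same over the type `La m`. -/
lemma sum_La : ∑ t : La m, (X : ℤ[X]) ^ t.1.card = FormulaN.Uniform.P m + X ^ m := by
  rw [← sum_laSet, ← Finset.sum_coe_sort (laSet m)]

/-! ## §2. Alive `k`-sets ↔ families of alive local parts with `k` letters -/

/-- total number of letters of a family of local parts. -/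
def akf (g : Fin n → La m) : ℕ := ∑ i, (g i).1.card

variable (m n) in
/-- the families of alive local parts with `k` letters in total. -/
def Aset (k : ℕ) : Finset (Fin n → La m) := Finset.univ.filter fun g => akf g = k

/-- membership in `Aset`. -/
lemma mem_Aset {k : ℕ} {g : Fin n → La m} : g ∈ Aset m n k ↔ akf g = k := by
  simp [Aset]

/-- the glued monomial of a family has the family's number of letters. -/
lemma card_glue_eq_akf (g : Fin n → La m) : (glue fun i => (g i).1).card = akf g := by
  rw [card_eq_sum_card_pb (glue fun i => (g i).1), akf]
  exact Finset.sum_congr rfl fun i _ => by rw [pb_glue]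

/-- **the alive `k`-sets are in bijection with the families of alive local parts with `k` letters** (block parts / gluing). -/
theorem card_aliveSet_eq_card_Aset (k : ℕ) : (aliveSet m n k).card = (Aset m n k).card := by
  refine Finset.card_bij' (fun s hs i => ⟨pb m n i s, alive_iff_mem_laSet.mp ((mem_aliveSet.mp hs).2 i)⟩)
    (fun g _ => glue fun i => (g i).1) (fun s hs => ?_) (fun g hg => ?_) (fun s _ => biUnion_lift_pb s) (fun g _ => ?_)
  · rw [mem_Aset, akf]
    show ∑ i, (pb m n i s).card = k
    rw [← card_eq_sum_card_pb s]
    exact (mem_aliveSet.mp hs).1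
  · rw [mem_aliveSet, card_glue_eq_akf, mem_Aset.mp hg]
    exact ⟨rfl, fun i => by rw [pb_glue]; exact alive_iff_mem_laSet.mpr (g i).2⟩
  · funext i
    exact Subtype.ext (pb_glue _ i)

/-! ## §3. The generating function `Σ_g X^{|g|} = (P_m + X^m)ⁿ` -/

/-- **generating function of the families of alive local parts**: `Σ_g X^{|g|} = (P_m + X^m)ⁿ`. -/
theorem sum_X_pow_akf : ∑ g : Fin n → La m, (X : ℤ[X]) ^ akf g = (FormulaN.Uniform.P m + X ^ m) ^ n := by
  have h : ∀ g : Fin n → La m, (X : ℤ[X]) ^ akf g = ∏ i, (X : ℤ[X]) ^ (g i).1.card := fun g => by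
    rw [akf, Finset.prod_pow_eq_pow_sum]
  simp_rw [h]
  classical
  rw [← sum_La, ← Fintype.piFinset_univ,
    ← Finset.prod_univ_sum (fun _ : Fin n => (Finset.univ : Finset (La m))) (fun _ t => (X : ℤ[X]) ^ t.1.card),
    Finset.prod_const, Finset.card_univ, Fintype.card_fin]

/-- coefficient extraction: **`#Aset(k) = [X^k](P_m + X^m)ⁿ`**. -/
theorem card_Aset_cast (k : ℕ) : ((Aset m n k).card : ℤ) = ((FormulaN.Uniform.P m + X ^ m) ^ n).coeff k := by
  have h : ∀ g : Fin n → La m, ((X : ℤ[X]) ^ akf g).coeff k = if akf g = k then 1 else 0 := fun g => by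
    rw [coeff_X_pow]
    exact if_congr eq_comm rfl rfl
  rw [← sum_X_pow_akf, finsetSum_coeff]
  simp_rw [h]
  rw [Finset.sum_boole, Aset]

/-! ## §4. The kernel census in every degree -/

/-- **`#alive(k) = [t^k](P_m(t) + t^m)ⁿ`** for every `m`, `n`, `k` (gen 6 had `[t^k]P_mⁿ` for `k < m`, where `t^m` cannot contribute). -/
theorem card_aliveSet_cast (k : ℕ) : ((aliveSet m n k).card : ℤ) = ((FormulaN.Uniform.P m + X ^ m) ^ n).coeff k := by
  rw [card_aliveSet_eq_card_Aset, card_Aset_cast]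

/-- **`#killed(k) = C((m+m)n, k) − [t^k](P_m(t) + t^m)ⁿ`** for every `m`, `n`, `k`: the number of killed monomials (gen 6's
`killedSet`; in degree 2 the `n·m²` split pairs) in closed form. -/
theorem card_killedSet_cast (k : ℕ) :
    ((killedSet m n k).card : ℤ) = (((m + m) * n).choose k : ℤ) - ((FormulaN.Uniform.P m + X ^ m) ^ n).coeff k := by
  rw [← card_aliveSet_cast, ← card_aliveSet_add_card_killedSet (m := m) (n := n) k, Nat.cast_add, add_sub_cancel_left]

/-- **`#alive(k) − #classes(k) = [t^k]((P_m + t^m)ⁿ − P_mⁿ)`** for every `m ≥ 1`, `n`, `k` (`#classes = |Kset m n k| = [t^k]P_mⁿ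
= rank`, p10 gen 4's `card_Kset`).  By the sibling leaf `WedgePointPairPowersKernelCollapse` (`card_canonSet_eq_card_Kset`,
`card_canonSet_add_card_collapsedSet`) the left side is the number of COLLAPSED `k`-sets = of collapse binomials in the kernel. -/
theorem card_aliveSet_sub_card_Kset (hm : 1 ≤ m) (k : ℕ) :
    ((aliveSet m n k).card : ℤ) - (Kset m n k).card = ((FormulaN.Uniform.P m + X ^ m) ^ n - FormulaN.Uniform.P m ^ n).coeff k := by
  rw [coeff_sub, card_aliveSet_cast, card_Kset hm, coeff_pairPoly_pow_cast]

/-- **binomial reading**: `[t^k]((P_m + t^m)ⁿ − P_mⁿ) = Σ_{j<n} C(n, j+1)·[t^k](t^{(j+1)m}·P_m^{n−(j+1)})`, the `j+1 ≥ 1` FULLY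
COLLAPSED blocks (each a top monomial `t^m`) chosen among `n`, the other blocks contributing a class of `P_m^{n−j−1}`. -/
theorem coeff_alive_pow_sub_eq_sum (k : ℕ) :
    ((FormulaN.Uniform.P m + X ^ m) ^ n - FormulaN.Uniform.P m ^ n).coeff k =
      ∑ j ∈ Finset.range n, (n.choose (j + 1) : ℤ) *
        (if (j + 1) * m ≤ k then (FormulaN.Uniform.P m ^ (n - (j + 1))).coeff (k - (j + 1) * m) else 0) := by
  have h : (FormulaN.Uniform.P m + X ^ m) ^ n - FormulaN.Uniform.P m ^ n =
      ∑ j ∈ Finset.range n, (n.choose (j + 1) : ℤ[X]) * (X ^ ((j + 1) * m) * FormulaN.Uniform.P m ^ (n - (j + 1))) := by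
    rw [add_comm, add_pow, Finset.sum_range_succ']
    simp only [pow_zero, one_mul, Nat.sub_zero, Nat.choose_zero_right, Nat.cast_one, mul_one, add_sub_cancel_right]
    exact Finset.sum_congr rfl fun j _ => by rw [← pow_mul, mul_comm m]; ring
  rw [h, finsetSum_coeff]
  refine Finset.sum_congr rfl fun j _ => ?_
  rw [coeff_natCast_mul, coeff_X_pow_mul']

/-- cross-check with the sibling leaf in degree `m` (`m ≥ 1`): **`[t^m]((P_m + t^m)ⁿ − P_mⁿ) = n`** — only `j = 1` collapsed
block fits, `C(n,1)·[t⁰]P_m^{n−1} = n`: the `n` collapsed lines `E_{Y_i} − λ·E_{X_i}` of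
`WedgePointPairPowersKernelCollapse.card_collapsedSet_self`. -/
theorem coeff_alive_pow_sub_self (hm : 1 ≤ m) :
    ((FormulaN.Uniform.P m + X ^ m) ^ n - FormulaN.Uniform.P m ^ n).coeff m = (n : ℤ) := by
  have hP0 : ∀ j : ℕ, (FormulaN.Uniform.P m ^ j).coeff 0 = 1 := fun j => by
    simp [coeff_zero_eq_eval_zero, FormulaN.Uniform.P, zero_pow (show m ≠ 0 by omega)]
  rw [coeff_alive_pow_sub_eq_sum]
  rcases Nat.eq_zero_or_pos n with rfl | hn
  · simp
  · rw [Finset.sum_eq_single_of_mem 0 (Finset.mem_range.mpr hn)]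
    · rw [zero_add, one_mul, if_pos le_rfl, Nat.sub_self, hP0, Nat.choose_one_right, mul_one]
    · intro j _ hj
      rw [if_neg, mul_zero]
      intro h
      rw [add_one_mul] at h
      have := Nat.mul_pos (Nat.pos_of_ne_zero hj) (show 0 < m by omega)
      omega

/-- surfaces (`m = 2`): the alive polynomial is `1 + 4t + 2t²` (`P₂ = 1 + 4t + t²` plus the top monomial). -/
theorem alivePoly_two : FormulaN.Uniform.P 2 + X ^ 2 = 1 + 4 * X + 2 * X ^ 2 := by
  rw [FormulaN.Uniform.P]
  ring

/-- curves (`m = 1`): the alive polynomial is `1 + 2t` (both letters of a block are alive singly; `P₁ = 1 + t`), so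
`#alive(k) = 2^k·C(n,k)` and `#alive − #classes = [t^k]((1+2t)ⁿ − (1+t)ⁿ) = (2^k − 1)·C(n,k)` collapsed `k`-sets. -/
theorem alivePoly_one : FormulaN.Uniform.P 1 + X ^ 1 = 1 + 2 * X := by
  rw [FormulaN.Uniform.P]
  ring

end Summit.Ventures.HSemireg.Wedge.PairPowers
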